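import Literature.Geometry.Riemannian.GurskyViaclovskyClosedness
import HarnessLib

/-!
# Gursky–Viaclovsky 2003, §2: the cone `Γ₂⁺`, the first Newton transformation and
# "the `C²` estimate implies uniform ellipticity" — proved steps towards
# `gurskyViaclovsky_pathClosed_weighted_four`

This file accompanies the named fact
`Literature.Geometry.Riemannian.gurskyViaclovsky_pathClosed_weighted_four`
(`GurskyViaclovskyClosedness.lean`: closedness of Gursky–Viaclovsky's solvable set `𝒮` along the
Weyl-weighted `σ₂` continuity path, J. Differential Geom. 63 (2003) 131–154, Prop. 6 and §5). The
printed proof of Prop. 6 reads: "the main fact used in deriving these estimates is that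
`σ₂^{1/2}(A^t)` is a concave function of the second derivative variables, which follows easily from
the inequality (convexity). Since `f(x) > 0`, the `C²` estimate implies uniform ellipticity, and the
`C^{2,α}` estimate then follows from the work of [Krylov] and [Evans] on concave, uniformly elliptic
equations." The two STRUCTURAL inputs of that sentence — concavity and uniform ellipticity on the
part of the cone `Γ₂⁺` cut out by a `C²` bound and a positive lower bound for `σ₂` — are the
finite-dimensional algebra of §2 of the paper (Def. 1: `Γ₂⁺ = {σ₂ > 0} ∩ {σ₁ > 0}`; Def. 2:
`T₁(A) = σ₁(A)·I − A`, `L^t(A) = T₁(A) + ((1−t)/2)σ₁(T₁(A))·I`; Prop. 1: (i) `Γ₂⁺` is an open convex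
cone, (ii) `A ∈ Γ₂⁺ ⇒ T₁(A) > 0`, hence `L^t(A) > 0` for `t ≤ 1`, (iii) `σ₂^{1/2}` is concave on
`Γ₂⁺`, "standard, [CNSIII], [Garding]"). They are PROVED here, QUANTITATIVELY, for symmetric
frame arrays `B : Fin 4 → Fin 4 → ℝ` (the components of `g⁻¹A^t_u` in a `g`-orthonormal frame, the
format of `PseudoRiemannianMetric.sigma2WeylSchoutenFrame` in `ChangGurskyYangProofs.lean`):

* `GurskyViaclovsky.sigma1/sigma2/newtonT1/ellOp/GammaTwoPos/sigma2Polar` — Def. 1, Def. 2 and the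
  polarised `σ₂(A,B) = ½(σ₁(A)σ₁(B) − ⟨A,B⟩)`;
* `three_mul_sq_mul_sigma2_le` — the key inequality `3|ξ|⁴σ₂(B) ≤ T₁(B)(ξ,ξ)·(|ξ|²σ₁(B) + 2B(ξ,ξ))`
  (Bessel's inequality for the Frobenius-orthogonal pair `ξ⊗ξ`, `|ξ|²δ − ξ⊗ξ`);
* `quadForm_newtonT1_pos` — **Prop. 1 (ii)**: `T₁(B) > 0` on `Γ₂⁺`; `quadForm_newtonT1_le_quadForm_ellOp`
  — `L^t(B) ≥ T₁(B)` for `t ≤ 1`;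
* `sigma2_div_sigma1_mul_le_quadForm_newtonT1`, `quadForm_newtonT1_le` — **uniform ellipticity**:
  `(σ₂/σ₁)|ξ|² ≤ T₁(B)(ξ,ξ) ≤ 3K|ξ|²` whenever `|B|² ≤ K²`; with `σ₂ ≥ c > 0` and `σ₁ ≤ 2K` this is
  `λ = c/(2K)`, `Λ = 3K` — "the `C²` estimate implies uniform ellipticity";
* `eight_thirds_mul_sigma2_le`, `sigma1_pos_of_sigma2_pos` — Maclaurin `σ₂ ≤ (3/8)σ₁²`, so a limit of
  admissible arrays with `σ₂ ≥ c > 0` stays admissible (`σ₁ ≥ 0 ∧ σ₂ > 0 ⇒ σ₁ > 0`), the cone step of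
  "Proposition (C2estimate) then implies that `𝒮` is closed" (§5);
* `sqrt_mul_sqrt_le_sigma2Polar` — **Gårding's inequality for `σ₂`**, `√σ₂(A)·√σ₂(B) ≤ σ₂(A,B)` on
  `Γ₂⁺`, whence **Prop. 1 (iii)** `concave_sqrt_sigma2` and the convexity half of **Prop. 1 (i)**
  `gammaTwoPos_convex`;
* bookkeeping for the closedness statement itself: the limit parameter of `s_k ≤ 1` is `≤ 1`
  (`le_one_of_tendsto_of_le_one`) and the trivial case `s_k = t` (`solvable_of_eq`).

Everything is proved; no definition of a named fact and no `sorry`. NOT here: the analytic heart of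
the closedness step (Evans–Krylov `C^{2,α}` estimates, Schauder regularity, Arzelà–Ascoli in
`C^{2,α}`), which Mathlib and the tree lack — see the docstring of the named fact.

## References

* M. J. Gursky, J. A. Viaclovsky, *A fully nonlinear equation on four-manifolds with positive
  scalar curvature*, J. Differential Geom. 63 (2003) 131–154, arXiv:math/0301350, §2 (Def. 1,
  Def. 2, Prop. 1) and §5 (Prop. 6, proof of Thm. 1). [GurskyViaclovsky2003]
* L. Gårding, *An inequality for hyperbolic polynomials*, J. Math. Mech. 8 (1959) 957–965.
  [Garding1959]
-/

noncomputable section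

open Finset Filter
open scoped Topology Manifold ContDiff

namespace Literature.Geometry.Riemannian

namespace GurskyViaclovsky

/-! ### Definitions 1 and 2 of Gursky–Viaclovsky, on frame arrays -/

section Defs

variable {ι : Type*} [Fintype ι]

/-- `σ₁(B) = tr B = Σ_a B_{aa}` of a frame array (Gursky–Viaclovsky 2003, Def. 1: "`σ₁ = λ₁ + ⋯ + λ₄`
denotes the trace"). [cite: GurskyViaclovsky2003, §2 Def. 1] -/
def sigma1 (B : ι → ι → ℝ) : ℝ := ∑ a, B a a

/-- `σ₂(B) = ½((tr B)² − tr(B²)) = Σ_{i<j} λ_iλ_j`, the second elementary symmetric function of the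
eigenvalues of a symmetric frame array, in the trace form used by
`PseudoRiemannianMetric.sigma2WeylSchoutenFrame` (Gursky–Viaclovsky 2003, Def. 1).
[cite: GurskyViaclovsky2003, §2 Def. 1] -/
def sigma2 (B : ι → ι → ℝ) : ℝ := 1 / 2 * ((∑ a, B a a) ^ 2 - ∑ a, ∑ b, B a b * B b a)

/-- The squared Frobenius norm `|B|² = Σ_{ab} B_{ab}²` of a frame array. [folklore] -/
def frameNormSq (B : ι → ι → ℝ) : ℝ := ∑ a, ∑ b, B a b ^ 2

/-- The Frobenius pairing `⟨A, B⟩ = Σ_{ab} A_{ab} B_{ab}` of two frame arrays. [folklore] -/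
def frameInner (A B : ι → ι → ℝ) : ℝ := ∑ a, ∑ b, A a b * B a b

/-- The polarised `σ₂`: `σ₂(A, B) = ½(σ₁(A)σ₁(B) − ⟨A, B⟩)`, so that `σ₂(B, B) = σ₂(B)` for symmetric
`B` (the bilinear form whose positivity on `Γ₂⁺` is Gårding's inequality). [folklore] -/
def sigma2Polar (A B : ι → ι → ℝ) : ℝ := 1 / 2 * (sigma1 A * sigma1 B - frameInner A B)

/-- The quadratic form `ξ ↦ Σ_{ab} B_{ab} ξ_a ξ_b` of a frame array. [folklore] -/
def quadForm (B : ι → ι → ℝ) (ξ : ι → ℝ) : ℝ := ∑ a, ∑ b, B a b * ξ a * ξ b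

/-- **The first Newton transformation** `T₁(B) = σ₁(B)·I − B` (Gursky–Viaclovsky 2003, Def. 2;
"the first Newton transformation is what arises from differentiation of `σ₂`").
[cite: GurskyViaclovsky2003, §2 Def. 2] -/
def newtonT1 [DecidableEq ι] (B : ι → ι → ℝ) : ι → ι → ℝ :=
  fun a b ↦ sigma1 B * frameDelta a b - B a b

/-- **The operator `L^t(B) = T₁(B) + ((1−t)/2)·σ₁(T₁(B))·I`** of Gursky–Viaclovsky 2003, Def. 2 —
the coefficient array of the principal part of the linearised path equation (proof of Prop. 2:
`𝓛^t(φ) = L^t(g⁻¹A^t_u)_{ij}(g⁻¹∇²φ)_{ij} − ⋯`). [cite: GurskyViaclovsky2003, §2 Def. 2] -/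
def ellOp [DecidableEq ι] (t : ℝ) (B : ι → ι → ℝ) : ι → ι → ℝ :=
  fun a b ↦ newtonT1 B a b + (1 - t) / 2 * sigma1 (newtonT1 B) * frameDelta a b

/-- **The cone `Γ₂⁺ = {σ₂ > 0} ∩ {σ₁ > 0}`** (Gursky–Viaclovsky 2003, Def. 1), as a predicate on frame
arrays ("the notation `A ∈ Γ₂⁺` will mean that the eigenvalues of `A` lie in the corresponding
set"; `σ₁`, `σ₂` are the symmetric functions of the eigenvalues). [cite: GurskyViaclovsky2003, §2 Def. 1] -/
def GammaTwoPos (B : ι → ι → ℝ) : Prop := 0 < sigma1 B ∧ 0 < sigma2 B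

/-- For a symmetric array `σ₂(B) = ½(σ₁(B)² − |B|²)` (the identity "`σ₂(A) = −½|A|² + ½σ₁(A)²`" of
Gursky–Viaclovsky 2003, proof of Lemma 3). [cite: GurskyViaclovsky2003, §5, proof of Lemma 3] -/
theorem sigma2_eq {B : ι → ι → ℝ} (hB : ∀ a b, B a b = B b a) :
    sigma2 B = 1 / 2 * (sigma1 B ^ 2 - frameNormSq B) := by
  simp only [sigma2, sigma1, frameNormSq]
  congr 2
  refine Finset.sum_congr rfl fun a _ ↦ Finset.sum_congr rfl fun b _ ↦ ?_
  rw [hB b a, sq]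

/-- `σ₂(B, B) = σ₂(B)` for symmetric `B`. [folklore] -/
theorem sigma2Polar_self {B : ι → ι → ℝ} (hB : ∀ a b, B a b = B b a) :
    sigma2Polar B B = sigma2 B := by
  rw [sigma2_eq hB, sigma2Polar, frameInner, frameNormSq, sq]
  congr 2
  exact Finset.sum_congr rfl fun a _ ↦ Finset.sum_congr rfl fun b _ ↦ (sq _).symm

/-- `σ₂(A, B)` is symmetric. [folklore] -/
theorem sigma2Polar_comm (A B : ι → ι → ℝ) : sigma2Polar A B = sigma2Polar B A := by
  simp only [sigma2Polar, frameInner, mul_comm (sigma1 A), mul_comm (A _ _)]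

end Defs

/-! ### Dimension four: Bessel's inequality and the first Newton transformation -/

section Four

variable {B : Fin 4 → Fin 4 → ℝ}

/-- `T₁(B)(ξ,ξ) = σ₁(B)|ξ|² − B(ξ,ξ)`. [cite: GurskyViaclovsky2003, §2 Def. 2] -/
theorem quadForm_newtonT1 (B : Fin 4 → Fin 4 → ℝ) (ξ : Fin 4 → ℝ) :
    quadForm (newtonT1 B) ξ = sigma1 B * (∑ a, ξ a ^ 2) - quadForm B ξ := by
  simp only [quadForm, newtonT1, sigma1, Fin.sum_univ_four, frameDelta, Fin.isValue, if_true,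
    Fin.reduceEq, if_false]
  ring

/-- `σ₁(T₁(B)) = 3σ₁(B)` in dimension four. [cite: GurskyViaclovsky2003, §2 Def. 2] -/
theorem sigma1_newtonT1 (B : Fin 4 → Fin 4 → ℝ) : sigma1 (newtonT1 B) = 3 * sigma1 B := by
  simp only [newtonT1, sigma1, Fin.sum_univ_four, frameDelta_self]
  ring

/-- `L^t(B)(ξ,ξ) = T₁(B)(ξ,ξ) + (3(1−t)/2)σ₁(B)|ξ|²` in dimension four.
[cite: GurskyViaclovsky2003, §2 Def. 2] -/
theorem quadForm_ellOp (t : ℝ) (B : Fin 4 → Fin 4 → ℝ) (ξ : Fin 4 → ℝ) :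
    quadForm (ellOp t B) ξ =
      quadForm (newtonT1 B) ξ + (1 - t) / 2 * (3 * sigma1 B) * ∑ a, ξ a ^ 2 := by
  rw [← sigma1_newtonT1]
  simp only [quadForm, ellOp, Fin.sum_univ_four, frameDelta, Fin.isValue, if_true, Fin.reduceEq,
    if_false]
  ring

/-- **Bessel's inequality for the pair `ξ ⊗ ξ`, `|ξ|²δ − ξ ⊗ ξ`** (Frobenius-orthogonal, of squared
norms `|ξ|⁴` and `3|ξ|⁴`): for a symmetric `4 × 4` array,
`|ξ|²·(3|ξ|²|B|² − 3B(ξ,ξ)² − (|ξ|²σ₁(B) − B(ξ,ξ))²) = ⅓|3|ξ|²B − 3B(ξ,ξ)ξ⊗ξ − (|ξ|²σ₁ − B(ξ,ξ))(|ξ|²δ − ξ⊗ξ)|² ≥ 0`.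
[folklore] -/
theorem bessel_four (hB : ∀ a b, B a b = B b a) (ξ : Fin 4 → ℝ) :
    0 ≤ (∑ a, ξ a ^ 2) ^ 2 *
      (3 * (∑ a, ξ a ^ 2) ^ 2 * frameNormSq B - 3 * quadForm B ξ ^ 2
        - ((∑ a, ξ a ^ 2) * sigma1 B - quadForm B ξ) ^ 2) := by
  have key : (∑ a, ∑ c, (3 * (∑ a, ξ a ^ 2) ^ 2 * B a c - 3 * quadForm B ξ * (ξ a * ξ c)
      - ((∑ a, ξ a ^ 2) * sigma1 B - quadForm B ξ) *
        ((∑ a, ξ a ^ 2) * frameDelta a c - ξ a * ξ c)) ^ 2) =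
      3 * ((∑ a, ξ a ^ 2) ^ 2 * (3 * (∑ a, ξ a ^ 2) ^ 2 * frameNormSq B - 3 * quadForm B ξ ^ 2
        - ((∑ a, ξ a ^ 2) * sigma1 B - quadForm B ξ) ^ 2)) := by
    simp only [quadForm, sigma1, frameNormSq, Fin.sum_univ_four, frameDelta, Fin.isValue, if_true,
      Fin.reduceEq, if_false]
    rw [hB 1 0, hB 2 0, hB 3 0, hB 2 1, hB 3 1, hB 3 2]
    ring
  have hsq : 0 ≤ ∑ a, ∑ c, (3 * (∑ a, ξ a ^ 2) ^ 2 * B a c - 3 * quadForm B ξ * (ξ a * ξ c)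
      - ((∑ a, ξ a ^ 2) * sigma1 B - quadForm B ξ) *
        ((∑ a, ξ a ^ 2) * frameDelta a c - ξ a * ξ c)) ^ 2 :=
    Finset.sum_nonneg fun a _ ↦ Finset.sum_nonneg fun c _ ↦ sq_nonneg _
  rw [key] at hsq
  linarith

/-- If `|ξ|² = 0` then `B(ξ,ξ) = 0`. [folklore] -/
theorem quadForm_eq_zero_of_sum_sq_eq_zero (B : Fin 4 → Fin 4 → ℝ) {ξ : Fin 4 → ℝ}
    (h : ∑ a, ξ a ^ 2 = 0) : quadForm B ξ = 0 := by
  have h0 : ∀ a, ξ a = 0 := by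
    intro a
    have := (Finset.sum_eq_zero_iff_of_nonneg fun b _ ↦ sq_nonneg (ξ b)).1 h a (Finset.mem_univ a)
    exact pow_eq_zero_iff (n := 2) (by norm_num) |>.1 this
  simp [quadForm, h0]

/-- Bessel's inequality divided by `|ξ|²`: `3B(ξ,ξ)² + (|ξ|²σ₁(B) − B(ξ,ξ))² ≤ 3|ξ|⁴|B|²` for a
symmetric `4 × 4` array (in particular `B(ξ,ξ)² ≤ |B|²|ξ|⁴`). [folklore] -/
theorem three_mul_quadForm_sq_add_le (hB : ∀ a b, B a b = B b a) (ξ : Fin 4 → ℝ) :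
    3 * quadForm B ξ ^ 2 + ((∑ a, ξ a ^ 2) * sigma1 B - quadForm B ξ) ^ 2 ≤
      3 * (∑ a, ξ a ^ 2) ^ 2 * frameNormSq B := by
  have h := bessel_four hB ξ
  rcases (Finset.sum_nonneg fun a (_ : a ∈ univ) ↦ sq_nonneg (ξ a)).eq_or_lt with hs | hs
  · rw [quadForm_eq_zero_of_sum_sq_eq_zero B hs.symm, ← hs]
    simp
  · have hs2 : 0 < (∑ a, ξ a ^ 2) ^ 2 := by positivity
    nlinarith

/-- **The key inequality**: for a symmetric `4 × 4` array,
`3|ξ|⁴ σ₂(B) ≤ T₁(B)(ξ,ξ) · (|ξ|²σ₁(B) + 2B(ξ,ξ))` — Bessel's inequality rewritten through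
`σ₂ = ½(σ₁² − |B|²)` and `T₁(B)(ξ,ξ) = |ξ|²σ₁ − B(ξ,ξ)`. [folklore] -/
theorem three_mul_sq_mul_sigma2_le (hB : ∀ a b, B a b = B b a) (ξ : Fin 4 → ℝ) :
    3 * (∑ a, ξ a ^ 2) ^ 2 * sigma2 B ≤
      quadForm (newtonT1 B) ξ * ((∑ a, ξ a ^ 2) * sigma1 B + 2 * quadForm B ξ) := by
  have h := three_mul_quadForm_sq_add_le hB ξ
  rw [quadForm_newtonT1, sigma2_eq hB]
  nlinarith

/-- **Gursky–Viaclovsky 2003, Prop. 1 (ii): `T₁(B)` is positive definite for `B ∈ Γ₂⁺`**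
(symmetric `4 × 4` frame arrays; quadratic-form version `T₁(B)(ξ,ξ) > 0` for `ξ ≠ 0`).
[cite: GurskyViaclovsky2003, §2 Prop. 1 (ii)] -/
theorem quadForm_newtonT1_pos (hB : ∀ a b, B a b = B b a) (hΓ : GammaTwoPos B) {ξ : Fin 4 → ℝ}
    (hξ : ξ ≠ 0) : 0 < quadForm (newtonT1 B) ξ := by
  obtain ⟨h1, h2⟩ := hΓ
  have hs : 0 < ∑ a, ξ a ^ 2 := by
    obtain ⟨a, ha⟩ : ∃ a, ξ a ≠ 0 := by
      by_contra h
      push Not at h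
      exact hξ (funext h)
    exact lt_of_lt_of_le (by positivity) (Finset.single_le_sum (fun b _ ↦ sq_nonneg (ξ b))
      (Finset.mem_univ a))
  have key := three_mul_sq_mul_sigma2_le hB ξ
  have hT := quadForm_newtonT1 B ξ
  by_contra hle
  push Not at hle
  -- with `T = T₁(B)(ξ,ξ) ≤ 0`: `|ξ|²σ₁ + 2B(ξ,ξ) = 3|ξ|²σ₁ − 2T > 0`, so the right side is `≤ 0`
  have hpos : 0 < (∑ a, ξ a ^ 2) * sigma1 B + 2 * quadForm B ξ := by nlinarith
  nlinarith [mul_pos (pow_pos hs 2) h2]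

/-- **Quantitative ellipticity from below**: for a symmetric `4 × 4` array with `σ₁(B) > 0` and
`σ₂(B) ≥ 0`, `(σ₂(B)/σ₁(B))·|ξ|² ≤ T₁(B)(ξ,ξ)` — the smallest eigenvalue of `T₁(B)` is at least
`σ₂/σ₁`. With `σ₂ ≥ c > 0` and `σ₁ ≤ 2K` (`|B|² ≤ K²`) this is the uniform lower ellipticity constant
`c/(2K)` of "the `C²` estimate implies uniform ellipticity" (proof of Prop. 6).
[cite: GurskyViaclovsky2003, §5, proof of Prop. 6] -/
theorem sigma2_div_sigma1_mul_le_quadForm_newtonT1 (hB : ∀ a b, B a b = B b a)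
    (h1 : 0 < sigma1 B) (h2 : 0 ≤ sigma2 B) (ξ : Fin 4 → ℝ) :
    sigma2 B / sigma1 B * ∑ a, ξ a ^ 2 ≤ quadForm (newtonT1 B) ξ := by
  have key := three_mul_sq_mul_sigma2_le hB ξ
  have hT := quadForm_newtonT1 B ξ
  have hs0 : 0 ≤ ∑ a, ξ a ^ 2 := Finset.sum_nonneg fun a _ ↦ sq_nonneg (ξ a)
  set s := ∑ a, ξ a ^ 2 with hs_def
  set T := quadForm (newtonT1 B) ξ with hT_def
  -- `T ≥ 0`: otherwise the right side `T(3sσ₁ − 2T)` of the key inequality is negative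
  have hT0 : 0 ≤ T := by
    by_contra hlt
    push Not at hlt
    have hb : quadForm B ξ = sigma1 B * s - T := by linarith
    have hpos : 0 < s * sigma1 B + 2 * quadForm B ξ := by
      rw [hb]; nlinarith [mul_nonneg hs0 h1.le]
    have hneg : T * (s * sigma1 B + 2 * quadForm B ξ) < 0 := mul_neg_of_neg_of_pos hlt hpos
    have hnn : 0 ≤ 3 * s ^ 2 * sigma2 B := by positivity
    linarith
  rcases hs0.eq_or_lt with hs | hs
  · rw [← hs]
    simpa using hT0
  · -- `3sσ₁T ≥ 3s²σ₂ + 2T² ≥ 3s²σ₂`, divide by `3s > 0` and by `σ₁ > 0`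
    have h3 : s * sigma2 B ≤ sigma1 B * T := by nlinarith [sq_nonneg T]
    rw [div_mul_eq_mul_div, div_le_iff₀ h1]
    linarith [mul_comm T (sigma1 B)]

/-- `σ₁(B)² ≤ 4|B|²` in dimension four (Cauchy–Schwarz on the diagonal). [folklore] -/
theorem sigma1_sq_le_four_mul_frameNormSq (B : Fin 4 → Fin 4 → ℝ) :
    sigma1 B ^ 2 ≤ 4 * frameNormSq B := by
  simp only [sigma1, frameNormSq, Fin.sum_univ_four]
  nlinarith [sq_nonneg (B 0 0 - B 1 1), sq_nonneg (B 0 0 - B 2 2), sq_nonneg (B 0 0 - B 3 3),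
    sq_nonneg (B 1 1 - B 2 2), sq_nonneg (B 1 1 - B 3 3), sq_nonneg (B 2 2 - B 3 3),
    sq_nonneg (B 0 1), sq_nonneg (B 0 2), sq_nonneg (B 0 3), sq_nonneg (B 1 0), sq_nonneg (B 1 2),
    sq_nonneg (B 1 3), sq_nonneg (B 2 0), sq_nonneg (B 2 1), sq_nonneg (B 2 3), sq_nonneg (B 3 0),
    sq_nonneg (B 3 1), sq_nonneg (B 3 2)]

/-- **Quantitative ellipticity from above**: `T₁(B)(ξ,ξ) ≤ 3K|ξ|²` when `|B|² ≤ K²` (symmetric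
`4 × 4` array; `σ₁ ≤ 2K` and `|B(ξ,ξ)| ≤ K|ξ|²`). [cite: GurskyViaclovsky2003, §5, proof of Prop. 6] -/
theorem quadForm_newtonT1_le (hB : ∀ a b, B a b = B b a) {K : ℝ} (hK : 0 ≤ K)
    (hBK : frameNormSq B ≤ K ^ 2) (ξ : Fin 4 → ℝ) :
    quadForm (newtonT1 B) ξ ≤ 3 * K * ∑ a, ξ a ^ 2 := by
  have hs0 : 0 ≤ ∑ a, ξ a ^ 2 := Finset.sum_nonneg fun a _ ↦ sq_nonneg (ξ a)
  set s := ∑ a, ξ a ^ 2 with hs_def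
  have h1 : sigma1 B ≤ 2 * K := by
    have h := sigma1_sq_le_four_mul_frameNormSq B
    have h' : sigma1 B ^ 2 ≤ (2 * K) ^ 2 := by nlinarith
    exact (abs_le_of_sq_le_sq' h' (by positivity)).2
  have h2 : -(K * s) ≤ quadForm B ξ := by
    have h := three_mul_quadForm_sq_add_le hB ξ
    have h' : quadForm B ξ ^ 2 ≤ (K * s) ^ 2 := by
      nlinarith [sq_nonneg (s * sigma1 B - quadForm B ξ), mul_nonneg (sq_nonneg s) (sub_nonneg.2 hBK)]
    exact (abs_le_of_sq_le_sq' h' (by positivity)).1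
  rw [quadForm_newtonT1]
  nlinarith

/-- **`L^t(B) ≥ T₁(B)` for `t ≤ 1` and `σ₁(B) ≥ 0`** ("Consequently, for `t ≤ 1`, `L^t(A)` is also
positive definite", Gursky–Viaclovsky 2003, Prop. 1 (ii)). [cite: GurskyViaclovsky2003, §2 Prop. 1 (ii)] -/
theorem quadForm_newtonT1_le_quadForm_ellOp {t : ℝ} (ht : t ≤ 1) (h1 : 0 ≤ sigma1 B)
    (ξ : Fin 4 → ℝ) : quadForm (newtonT1 B) ξ ≤ quadForm (ellOp t B) ξ := by
  rw [quadForm_ellOp]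
  have hs0 : 0 ≤ ∑ a, ξ a ^ 2 := Finset.sum_nonneg fun a _ ↦ sq_nonneg (ξ a)
  nlinarith [mul_nonneg (mul_nonneg (sub_nonneg.2 ht) h1) hs0]

/-- **`L^t(B)` is positive definite for `B ∈ Γ₂⁺` and `t ≤ 1`** (Gursky–Viaclovsky 2003,
Prop. 1 (ii), second sentence; this is the ellipticity of the linearised path equation, Prop. 2).
[cite: GurskyViaclovsky2003, §2 Prop. 1 (ii)] -/
theorem quadForm_ellOp_pos (hB : ∀ a b, B a b = B b a) (hΓ : GammaTwoPos B) {t : ℝ} (ht : t ≤ 1)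
    {ξ : Fin 4 → ℝ} (hξ : ξ ≠ 0) : 0 < quadForm (ellOp t B) ξ :=
  (quadForm_newtonT1_pos hB hΓ hξ).trans_le (quadForm_newtonT1_le_quadForm_ellOp ht hΓ.1.le ξ)

/-- **Uniform ellipticity of `L^t` on the bounded part of the cone**: for a symmetric `4 × 4` array
with `σ₁ > 0`, `σ₂ ≥ c`, `|B|² ≤ K²` and `t ≤ 1`,
`(c/(2K))|ξ|² ≤ L^t(B)(ξ,ξ) ≤ 3K(2 − t)|ξ|²`. [cite: GurskyViaclovsky2003, §5, proof of Prop. 6] -/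
theorem uniformlyElliptic_ellOp (hB : ∀ a b, B a b = B b a) (h1 : 0 < sigma1 B) {c K t : ℝ}
    (hc : 0 ≤ c) (hcB : c ≤ sigma2 B) (hK : 0 < K) (hBK : frameNormSq B ≤ K ^ 2) (ht : t ≤ 1)
    (ξ : Fin 4 → ℝ) :
    c / (2 * K) * ∑ a, ξ a ^ 2 ≤ quadForm (ellOp t B) ξ ∧
      quadForm (ellOp t B) ξ ≤ 3 * K * (2 - t) * ∑ a, ξ a ^ 2 := by
  have hs0 : 0 ≤ ∑ a, ξ a ^ 2 := Finset.sum_nonneg fun a _ ↦ sq_nonneg (ξ a)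
  set s := ∑ a, ξ a ^ 2 with hs_def
  have hσK : sigma1 B ≤ 2 * K := by
    have h := sigma1_sq_le_four_mul_frameNormSq B
    have h' : sigma1 B ^ 2 ≤ (2 * K) ^ 2 := by nlinarith
    exact (abs_le_of_sq_le_sq' h' (by positivity)).2
  constructor
  · have hlow := sigma2_div_sigma1_mul_le_quadForm_newtonT1 hB h1 (hc.trans hcB) ξ
    have hmono := quadForm_newtonT1_le_quadForm_ellOp ht h1.le ξ
    have hcmp : c / (2 * K) ≤ sigma2 B / sigma1 B := by
      rw [div_le_div_iff₀ (by positivity) h1]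
      nlinarith
    calc c / (2 * K) * s ≤ sigma2 B / sigma1 B * s := mul_le_mul_of_nonneg_right hcmp hs0
      _ ≤ _ := hlow.trans hmono
  · rw [quadForm_ellOp]
    have hup := quadForm_newtonT1_le hB hK.le hBK ξ
    nlinarith [mul_nonneg (sub_nonneg.2 ht) hs0, mul_nonneg (mul_nonneg (sub_nonneg.2 ht) hs0) hK.le]

/-! ### Admissibility survives limits: `σ₂ ≥ c > 0` and `σ₁ ≥ 0` force `σ₁ > 0` -/

/-- **Maclaurin's inequality in dimension four**: `(8/3)σ₂(B) ≤ σ₁(B)²` for a symmetric array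
(from `|B|² ≥ ¼σ₁²`; equivalently Newton's `(4/√6)σ₂^{1/2} ≤ σ₁` used in the proof of Prop. 3).
[cite: GurskyViaclovsky2003, §3, proof of Prop. 3] -/
theorem eight_thirds_mul_sigma2_le (hB : ∀ a b, B a b = B b a) :
    8 / 3 * sigma2 B ≤ sigma1 B ^ 2 := by
  rw [sigma2_eq hB]
  nlinarith [sigma1_sq_le_four_mul_frameNormSq B]

/-- **The cone step of closedness**: a symmetric array with `σ₂(B) > 0` and `σ₁(B) ≥ 0` has
`σ₁(B) > 0`, i.e. lies in `Γ₂⁺` — limits of admissible solutions with `σ₂` bounded below stay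
admissible (as `σ₁ = 0` would give `σ₂ = −½|B|² ≤ 0`). [cite: GurskyViaclovsky2003, §5, proof of Thm. 1] -/
theorem sigma1_pos_of_sigma2_pos (hB : ∀ a b, B a b = B b a) (h2 : 0 < sigma2 B)
    (h1 : 0 ≤ sigma1 B) : 0 < sigma1 B := by
  rcases h1.eq_or_lt with h | h
  · have := eight_thirds_mul_sigma2_le hB
    rw [← h] at this
    nlinarith
  · exact h

/-- Quantitatively: `σ₂(B) ≥ c ≥ 0` and `σ₁(B) ≥ 0` give `σ₁(B) ≥ √(8c/3)`. [folklore] -/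
theorem sqrt_le_sigma1 (hB : ∀ a b, B a b = B b a) {c : ℝ} (hcB : c ≤ sigma2 B)
    (h1 : 0 ≤ sigma1 B) : Real.sqrt (8 / 3 * c) ≤ sigma1 B := by
  refine Real.sqrt_le_iff.2 ⟨h1, ?_⟩
  nlinarith [eight_thirds_mul_sigma2_le hB]

/-- Membership in `Γ₂⁺` from `σ₂ > 0` and `σ₁ ≥ 0`. [cite: GurskyViaclovsky2003, §2 Def. 1] -/
theorem gammaTwoPos_of_sigma2_pos (hB : ∀ a b, B a b = B b a) (h2 : 0 < sigma2 B)
    (h1 : 0 ≤ sigma1 B) : GammaTwoPos B :=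
  ⟨sigma1_pos_of_sigma2_pos hB h2 h1, h2⟩

end Four

/-! ### Gårding's inequality for `σ₂` and the concavity of `σ₂^{1/2}` (Prop. 1 (iii)) -/

section Garding

variable {A B : Fin 4 → Fin 4 → ℝ}

/-- The "reverse Cauchy–Schwarz" inequality behind Gårding's inequality, as real algebra: if
`W² ≤ UV`, `U, V ≥ 0`, `0 < τ`, `0 < τ'`, `U < ¾τ²`, `V < ¾τ'²`, then
`√(¾τ² − U)·√(¾τ'² − V) ≤ ¾ττ' − W`. [folklore] -/
theorem sqrt_mul_sqrt_le_of_sq_le {τ τ' U V W : ℝ} (hτ : 0 < τ) (hτ' : 0 < τ') (hU : 0 ≤ U)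
    (hV : 0 ≤ V) (hW : W ^ 2 ≤ U * V) (hUτ : U < 3 / 4 * τ ^ 2) (hVτ : V < 3 / 4 * τ' ^ 2) :
    Real.sqrt (3 / 4 * τ ^ 2 - U) * Real.sqrt (3 / 4 * τ' ^ 2 - V) ≤ 3 / 4 * τ * τ' - W := by
  set x := Real.sqrt U with hx
  set y := Real.sqrt V with hy
  have hx0 : 0 ≤ x := Real.sqrt_nonneg U
  have hy0 : 0 ≤ y := Real.sqrt_nonneg V
  have hxU : x ^ 2 = U := Real.sq_sqrt hU
  have hyV : y ^ 2 = V := Real.sq_sqrt hV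
  -- `W ≤ xy`
  have hWxy : W ≤ x * y := by
    have : W ^ 2 ≤ (x * y) ^ 2 := by rw [mul_pow, hxU, hyV]; exact hW
    exact (abs_le_of_sq_le_sq' this (mul_nonneg hx0 hy0)).2
  -- `x < (√3/2)τ`, `y < (√3/2)τ'` in squared form
  have hxτ : x ^ 2 < 3 / 4 * τ ^ 2 := by rw [hxU]; exact hUτ
  have hyτ : y ^ 2 < 3 / 4 * τ' ^ 2 := by rw [hyV]; exact hVτ
  -- `D = ¾ττ' − xy > 0` and `D² − (¾τ² − x²)(¾τ'² − y²) = ¾(τy − τ'x)² ≥ 0`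
  have hD : 0 < 3 / 4 * τ * τ' - x * y := by
    nlinarith [mul_pos hτ hτ', sq_nonneg (τ * y - τ' * x), sq_nonneg (x * τ' - y * τ),
      mul_nonneg hx0 hy0]
  have hprod : (3 / 4 * τ ^ 2 - U) * (3 / 4 * τ' ^ 2 - V) ≤ (3 / 4 * τ * τ' - x * y) ^ 2 := by
    rw [← hxU, ← hyV]
    nlinarith [sq_nonneg (τ * y - τ' * x)]
  calc Real.sqrt (3 / 4 * τ ^ 2 - U) * Real.sqrt (3 / 4 * τ' ^ 2 - V)
      = Real.sqrt ((3 / 4 * τ ^ 2 - U) * (3 / 4 * τ' ^ 2 - V)) :=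
        (Real.sqrt_mul (by linarith) _).symm
    _ ≤ Real.sqrt ((3 / 4 * τ * τ' - x * y) ^ 2) := Real.sqrt_le_sqrt hprod
    _ = 3 / 4 * τ * τ' - x * y := Real.sqrt_sq hD.le
    _ ≤ 3 / 4 * τ * τ' - W := by linarith

/-- The trace-free parts: `⟨A°, B°⟩ = ⟨A, B⟩ − ¼σ₁(A)σ₁(B)` where `A° = A − ¼σ₁(A)δ`, and the
Cauchy–Schwarz inequality `⟨A°, B°⟩² ≤ |A°|²|B°|²`, in dimension four. [folklore] -/
theorem frameInner_traceFree_sq_le (A B : Fin 4 → Fin 4 → ℝ) :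
    (frameInner A B - sigma1 A * sigma1 B / 4) ^ 2 ≤
      (frameNormSq A - sigma1 A ^ 2 / 4) * (frameNormSq B - sigma1 B ^ 2 / 4) := by
  -- Cauchy–Schwarz for the arrays `A°`, `B°` indexed by `Fin 4 × Fin 4`
  set A' : Fin 4 × Fin 4 → ℝ := fun p ↦ A p.1 p.2 - sigma1 A / 4 * frameDelta p.1 p.2 with hA'
  set B' : Fin 4 × Fin 4 → ℝ := fun p ↦ B p.1 p.2 - sigma1 B / 4 * frameDelta p.1 p.2 with hB'
  have hCS := Finset.sum_mul_sq_le_sq_mul_sq (Finset.univ : Finset (Fin 4 × Fin 4)) A' B'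
  have h1 : ∑ p, A' p * B' p = frameInner A B - sigma1 A * sigma1 B / 4 := by
    rw [Fintype.sum_prod_type]
    simp only [hA', hB', frameInner, sigma1, Fin.sum_univ_four, frameDelta, Fin.isValue, if_true,
      Fin.reduceEq, if_false]
    ring
  have h2 : ∑ p, A' p ^ 2 = frameNormSq A - sigma1 A ^ 2 / 4 := by
    rw [Fintype.sum_prod_type]
    simp only [hA', frameNormSq, sigma1, Fin.sum_univ_four, frameDelta, Fin.isValue, if_true,
      Fin.reduceEq, if_false]
    ring
  have h3 : ∑ p, B' p ^ 2 = frameNormSq B - sigma1 B ^ 2 / 4 := by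
    rw [Fintype.sum_prod_type]
    simp only [hB', frameNormSq, sigma1, Fin.sum_univ_four, frameDelta, Fin.isValue, if_true,
      Fin.reduceEq, if_false]
    ring
  rw [h1, h2, h3] at hCS
  exact hCS

/-- **Gårding's inequality for `σ₂` in dimension four**: for symmetric `A, B ∈ Γ₂⁺`,
`√σ₂(A) · √σ₂(B) ≤ σ₂(A, B) = ½(σ₁(A)σ₁(B) − ⟨A, B⟩)` — the polarised form of the hyperbolic
polynomial `σ₂` is bounded below by the geometric mean on its positive cone (Gårding 1959; the
inequality (convexity) of Gursky–Viaclovsky 2003, Prop. 1 (iii), is its consequence below). Proof: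
`2σ₂ = ¾σ₁² − |B°|²` is a Minkowski form in `(σ₁, B°)` and `Γ₂⁺` its future cone; reverse
Cauchy–Schwarz (the source: "The proof of this proposition is standard, and may be found in
[CNSIII] and [Garding]"). [cite: GurskyViaclovsky2003, §2 Prop. 1 (iii)] -/
theorem sqrt_mul_sqrt_le_sigma2Polar (hA : ∀ a b, A a b = A b a) (hB : ∀ a b, B a b = B b a)
    (hΓA : GammaTwoPos A) (hΓB : GammaTwoPos B) :
    Real.sqrt (sigma2 A) * Real.sqrt (sigma2 B) ≤ sigma2Polar A B := by
  obtain ⟨hA1, hA2⟩ := hΓA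
  obtain ⟨hB1, hB2⟩ := hΓB
  have hNA : sigma1 A ^ 2 / 4 ≤ frameNormSq A := by
    nlinarith [sigma1_sq_le_four_mul_frameNormSq A]
  have hNB : sigma1 B ^ 2 / 4 ≤ frameNormSq B := by
    nlinarith [sigma1_sq_le_four_mul_frameNormSq B]
  have hA2' := hA2
  have hB2' := hB2
  rw [sigma2_eq hA] at hA2 ⊢
  rw [sigma2_eq hB] at hB2 ⊢
  have hCS := frameInner_traceFree_sq_le A B
  have key := sqrt_mul_sqrt_le_of_sq_le (U := frameNormSq A - sigma1 A ^ 2 / 4)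
    (V := frameNormSq B - sigma1 B ^ 2 / 4) (W := frameInner A B - sigma1 A * sigma1 B / 4)
    hA1 hB1 (sub_nonneg.2 hNA) (sub_nonneg.2 hNB) hCS (by linarith) (by linarith)
  have eA : 1 / 2 * (sigma1 A ^ 2 - frameNormSq A) =
      (1 / 2) * (3 / 4 * sigma1 A ^ 2 - (frameNormSq A - sigma1 A ^ 2 / 4)) := by ring
  have eB : 1 / 2 * (sigma1 B ^ 2 - frameNormSq B) =
      (1 / 2) * (3 / 4 * sigma1 B ^ 2 - (frameNormSq B - sigma1 B ^ 2 / 4)) := by ring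
  rw [eA, eB, Real.sqrt_mul (by norm_num) , Real.sqrt_mul (by norm_num), sigma2Polar]
  have hhalf : Real.sqrt (1 / 2) * Real.sqrt (1 / 2) = 1 / 2 := by
    rw [← Real.sqrt_mul (by norm_num), Real.sqrt_mul_self (by norm_num)]
  have h0 : 0 ≤ Real.sqrt (1 / 2) := Real.sqrt_nonneg _
  calc Real.sqrt (1 / 2) * Real.sqrt (3 / 4 * sigma1 A ^ 2 - (frameNormSq A - sigma1 A ^ 2 / 4)) *
        (Real.sqrt (1 / 2) * Real.sqrt (3 / 4 * sigma1 B ^ 2 - (frameNormSq B - sigma1 B ^ 2 / 4)))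
      = (Real.sqrt (1 / 2) * Real.sqrt (1 / 2)) *
          (Real.sqrt (3 / 4 * sigma1 A ^ 2 - (frameNormSq A - sigma1 A ^ 2 / 4)) *
            Real.sqrt (3 / 4 * sigma1 B ^ 2 - (frameNormSq B - sigma1 B ^ 2 / 4))) := by ring
    _ ≤ 1 / 2 * (3 / 4 * sigma1 A * sigma1 B - (frameInner A B - sigma1 A * sigma1 B / 4)) := by
        rw [hhalf]; exact mul_le_mul_of_nonneg_left key (by norm_num)
    _ = 1 / 2 * (sigma1 A * sigma1 B - frameInner A B) := by ring

/-- `σ₂` of a two-term combination: `σ₂(αA + βB) = α²σ₂(A) + β²σ₂(B) + 2αβ σ₂(A,B)` for symmetric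
arrays. [folklore] -/
theorem sigma2_smul_add_smul (hA : ∀ a b, A a b = A b a) (hB : ∀ a b, B a b = B b a) (α β : ℝ) :
    sigma2 (fun a b ↦ α * A a b + β * B a b) =
      α ^ 2 * sigma2 A + β ^ 2 * sigma2 B + 2 * α * β * sigma2Polar A B := by
  simp only [sigma2, sigma2Polar, sigma1, frameInner, Fin.sum_univ_four]
  rw [hA 1 0, hA 2 0, hA 3 0, hA 2 1, hA 3 1, hA 3 2, hB 1 0, hB 2 0, hB 3 0, hB 2 1, hB 3 1, hB 3 2]
  ring

/-- `σ₁` is linear. [folklore] -/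
theorem sigma1_smul_add_smul (A B : Fin 4 → Fin 4 → ℝ) (α β : ℝ) :
    sigma1 (fun a b ↦ α * A a b + β * B a b) = α * sigma1 A + β * sigma1 B := by
  simp only [sigma1, Finset.mul_sum, ← Finset.sum_add_distrib]

/-- **Gursky–Viaclovsky 2003, Prop. 1 (iii): `σ₂^{1/2}` is concave on `Γ₂⁺`** —
`(1−s)σ₂(A)^{1/2} + sσ₂(B)^{1/2} ≤ σ₂((1−s)A + sB)^{1/2}` for symmetric `A, B ∈ Γ₂⁺` and
`s ∈ [0,1]` ("the main fact used in deriving these estimates is that `σ₂^{1/2}(A^t)` is a concave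
function of the second derivative variables", proof of Prop. 6). [cite: GurskyViaclovsky2003, §2 Prop. 1 (iii)] -/
theorem concave_sqrt_sigma2 (hA : ∀ a b, A a b = A b a) (hB : ∀ a b, B a b = B b a)
    (hΓA : GammaTwoPos A) (hΓB : GammaTwoPos B) {s : ℝ} (hs0 : 0 ≤ s) (hs1 : s ≤ 1) :
    (1 - s) * Real.sqrt (sigma2 A) + s * Real.sqrt (sigma2 B) ≤
      Real.sqrt (sigma2 (fun a b ↦ (1 - s) * A a b + s * B a b)) := by
  have hG := sqrt_mul_sqrt_le_sigma2Polar hA hB hΓA hΓB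
  have hexp := sigma2_smul_add_smul hA hB (1 - s) s
  have hsqA : Real.sqrt (sigma2 A) ^ 2 = sigma2 A := Real.sq_sqrt hΓA.2.le
  have hsqB : Real.sqrt (sigma2 B) ^ 2 = sigma2 B := Real.sq_sqrt hΓB.2.le
  have hnn : 0 ≤ (1 - s) * Real.sqrt (sigma2 A) + s * Real.sqrt (sigma2 B) :=
    add_nonneg (mul_nonneg (sub_nonneg.2 hs1) (Real.sqrt_nonneg _)) (mul_nonneg hs0 (Real.sqrt_nonneg _))
  refine Real.le_sqrt_of_sq_le ?_   -- `le_sqrt` via squares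
  rw [hexp]
  have hss : 0 ≤ 2 * (1 - s) * s := by nlinarith
  calc ((1 - s) * Real.sqrt (sigma2 A) + s * Real.sqrt (sigma2 B)) ^ 2
      = (1 - s) ^ 2 * Real.sqrt (sigma2 A) ^ 2 + s ^ 2 * Real.sqrt (sigma2 B) ^ 2 +
          2 * (1 - s) * s * (Real.sqrt (sigma2 A) * Real.sqrt (sigma2 B)) := by ring
    _ ≤ (1 - s) ^ 2 * sigma2 A + s ^ 2 * sigma2 B + 2 * (1 - s) * s * sigma2Polar A B := by
        rw [hsqA, hsqB]
        linarith [mul_le_mul_of_nonneg_left hG hss]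

/-- **The convexity half of Gursky–Viaclovsky 2003, Prop. 1 (i)**: `Γ₂⁺` is convex (for symmetric
`4 × 4` frame arrays): `(1−s)A + sB ∈ Γ₂⁺` for `A, B ∈ Γ₂⁺`, `s ∈ [0,1]`.
[cite: GurskyViaclovsky2003, §2 Prop. 1 (i)] -/
theorem gammaTwoPos_convex (hA : ∀ a b, A a b = A b a) (hB : ∀ a b, B a b = B b a)
    (hΓA : GammaTwoPos A) (hΓB : GammaTwoPos B) {s : ℝ} (hs0 : 0 ≤ s) (hs1 : s ≤ 1) :
    GammaTwoPos (fun a b ↦ (1 - s) * A a b + s * B a b) := by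
  have hG := sqrt_mul_sqrt_le_sigma2Polar hA hB hΓA hΓB
  have hG0 : 0 ≤ sigma2Polar A B :=
    le_trans (mul_nonneg (Real.sqrt_nonneg _) (Real.sqrt_nonneg _)) hG
  refine ⟨?_, ?_⟩
  · rw [sigma1_smul_add_smul]
    rcases hs0.eq_or_lt with h | h
    · rw [← h]; simpa using hΓA.1
    · nlinarith [hΓA.1, hΓB.1, mul_pos h hΓB.1, mul_nonneg (sub_nonneg.2 hs1) hΓA.1.le]
  · rw [sigma2_smul_add_smul hA hB]
    rcases hs0.eq_or_lt with h | h
    · rw [← h]; simpa using hΓA.2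
    · nlinarith [hΓA.2, hΓB.2, mul_pos (mul_pos h h) hΓB.2,
        mul_nonneg (sq_nonneg (1 - s)) hΓA.2.le, mul_nonneg (mul_nonneg (sub_nonneg.2 hs1) hs0) hG0]

end Garding

/-! ### Bookkeeping for the closedness statement -/

section Bookkeeping

/-- The limit parameter of a sequence `s_k ≤ 1` is `≤ 1` (so the limit equation is still below
`t = 1`, where `L^t` is elliptic on `Γ₂⁺`). [folklore] -/
theorem le_one_of_tendsto_of_le_one {s : ℕ → ℝ} {t : ℝ} (hs : Tendsto s atTop (𝓝 t))
    (h1 : ∀ k, s k ≤ 1) : t ≤ 1 :=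
  le_of_tendsto' hs h1

variable {M : Type*} [TopologicalSpace M] [ChartedSpace (EuclideanSpace ℝ (Fin 4)) M]
  [IsManifold (𝓡 4) ∞ M]

open Literature.Geometry.Lorentzian (PseudoRiemannianMetric) in
/-- The trivial case of closedness: if the limit parameter is attained, `t = s_k`, the `k`-th
solution witnesses `t ∈ 𝒮`. [cite: GurskyViaclovsky2003, §5 (the set 𝒮)] -/
theorem solvable_of_eq
    (g : PseudoRiemannianMetric (𝓡 4) ∞ (EuclideanSpace ℝ (Fin 4)) (TangentSpace (𝓡 4) : M → Type _))
    {q : M → ℝ} {s : ℕ → ℝ} {t : ℝ} {k : ℕ} (hk : s k = t)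
    (h : ∃ (h : PseudoRiemannianMetric (𝓡 4) ∞ (EuclideanSpace ℝ (Fin 4))
        (TangentSpace (𝓡 4) : M → Type _)) (_ : h.HasLeviCivita) (u : M → ℝ),
        GurskyViaclovskyPath.IsPathSolution g h u (s k) q) :
    GurskyViaclovskyPath.Solvable g t q := by
  obtain ⟨h, hLC, u, hsol⟩ := h
  exact ⟨h, hLC, u, hk ▸ hsol⟩

end Bookkeeping

end GurskyViaclovsky

end Literature.Geometry.Riemannian
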